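import Literature.AlgebraicGeometry.Frobenioids.ArchimedeanBoundaryOpens
import HarnessLib

/-!
# Frobenioids II, Theorem 3.6 (vii): the functor `C^imtr-pre_A → Open⁰(∂A_A)` is an EQUIVALENCE — PROVED
# for `C = C^ℤ` (full, essentially surjective; conclusion `thm36vii_equiv_C`)

Mochizuki, *The geometry of Frobenioids II*, Kyushu J. Math. **62** (2008) 401–460, §3, Theorem 3.6 (vii),
author's kurims text pp. 37–38 [cite: MochizukiFrdII2008, Thm 3.6 (vii) p.37]: "the assignment that maps an
isometric pre-step `B → A` of `F` to the image of the boundary `∂A_B` … in the boundary `∂A_A` …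
determines an equivalence of categories […] `F^imtr-pre_A ⥲ Open⁰(∂A_A)`".

Continuation of `ArchimedeanBoundaryOpens.lean` (the functor `bdFunctor`, faithfulness): here FULLNESS (an
inclusion of boundary images gives an inclusion of direction sets, whence a connecting linear arrow
`B → B'` over `A`, built with `C0.linHom` of `ArchimedeanDirections.lean`), ESSENTIAL SURJECTIVITY for
complex `A` (a connected open `U ⊆ ∂A_A` is the boundary image of the object with the base and tip of `A`
and angular part `U/tip(A)`; "`A` complex" is needed because real objects have isotropic regions), and the
DISCHARGE `thm36vii_equiv_C` of the clause `ArchFrd.Thm36vii_equiv` at the archimedean Frobenioid `C π` of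
Example 3.3 over ANY base `π : D → D₀` (instance of `ArchimedeanTheoremsInstances.lean`). Together with
`thm36vii_recover_C` and `thm36vii_torsor_C` this completes Theorem 3.6 (vii) for `C`. Everything is PROVED;
no statement of the paper is strengthened; nothing here bears on [IUTchIII].
-/

namespace Literature.AlgebraicGeometry.Frobenioids

open CategoryTheory Topology
open scoped Pointwise

noncomputable section

universe v u

namespace ArchFrd

variable {D : Type u} [Category.{v} D] (π : D ⥤ D0) (A : C π)

/-! ### Full: from an inclusion of boundary images to a connecting arrow -/

section Full

variable {A}
variable (f f' : ImtrPreOver (C.toElem π) A) (hle : (bdOpen π A f : Set ↥(bd π A)) ⊆ bdOpen π A f')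

include hle in
/-- An inclusion of boundary images gives an inclusion of direction sets.
[cite: MochizukiFrdII2008, Thm 3.6 (vii) p.37] -/
theorem dirIm_subset_of_subset : C0.dirIm f.obj.hom.fst ⊆ C0.dirIm f'.obj.hom.fst := by
  intro v hv
  have hvA : v ∈ A.fst.region.dir := C0.dirIm_subset_dir _ (ImtrPre.degFr_eq f) hv
  let x : ↥(bd π A) := ⟨(v : ℂˣ) * ofPosReal ℂ A.fst.region.tip, A.fst.region.coe_mul_ofPosReal_mem_boundary hvA⟩
  have hux : unitPart ℂ (x : ℂˣ) = v := (unitPart_absHom_polar v _).1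
  have hx : x ∈ bdOpen π A f := by rw [mem_bdOpen_iff_unitPart, hux]; exact hv
  have hx' := hle hx
  rw [SetLike.mem_coe, mem_bdOpen_iff_unitPart, hux] at hx'
  exact hx'

/-- The `D`-component of the connecting arrow: `φ_D ≫ φ'_D⁻¹`. [cite: MochizukiFrdII2008, Thm 3.6 (vii) p.37] -/
def connSnd : f.obj.left.snd ⟶ f'.obj.left.snd :=
  haveI := ImtrPre.isIso_snd f'
  f.obj.hom.snd ≫ inv f'.obj.hom.snd

/-- The `D₀`-base of the connecting arrow (typed over found's `baseObj`, like `FiberProduct.e`).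
[cite: MochizukiFrdII2008, Thm 3.6 (vii) p.37] -/
def connBase : PreFrobenioid.baseObj C0.toElem f.obj.left.fst ⟶ PreFrobenioid.baseObj C0.toElem f'.obj.left.fst :=
  f.obj.left.e.hom ≫ π.map (connSnd π f f') ≫ f'.obj.left.e.inv

/-- The base of the connecting arrow composes with `Base(φ')` to `Base(φ)`.
[cite: MochizukiFrdII2008, Thm 3.6 (vii) p.37] -/
theorem connBase_comp :
    connBase π f f' ≫ PreFrobenioid.Base C0.toElem f'.obj.hom.fst = PreFrobenioid.Base C0.toElem f.obj.hom.fst := by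
  haveI := ImtrPre.isIso_snd f'
  refine (cancel_mono A.e.hom).1 ?_
  rw [Category.assoc, PreFrobenioid.FiberProduct.hom_w, PreFrobenioid.FiberProduct.hom_w, connBase, connSnd]
  simp only [Category.assoc, Iso.inv_hom_id_assoc, ← π.map_comp, IsIso.inv_hom_id, Category.comp_id]

/-- The twist of the connecting base `b`: `twists(Base φ) = twists(b) + twists(Base φ')`.
[cite: MochizukiFrdII2008, Def 3.1 (i) p.23] -/
theorem twists_connBase :
    D0.Hom.twists (C0.Base f.obj.hom.fst) =
      xor (D0.Hom.twists (connBase π f f')) (D0.Hom.twists (C0.Base f'.obj.hom.fst)) := by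
  haveI := ImtrPre.isIso_base_fst' f'
  have h := D0.twists_comp_of_isIso (connBase π f f') (PreFrobenioid.Base C0.toElem f'.obj.hom.fst)
  rw [connBase_comp π f f'] at h
  exact h

/-- The scalar of the connecting arrow: `c · b(c')⁻¹`. [cite: MochizukiFrdII2008, Thm 3.6 (vii) p.37] -/
def connScalar : ℂˣ :=
  C0.scalar f.obj.hom.fst * ((connBase π f f').act (C0.scalar f'.obj.hom.fst))⁻¹

/-- The connecting scalar is a scalar of the base field of `B`. [cite: MochizukiFrdII2008, Ex 3.3 (i) p.27] -/
theorem connScalar_mem : connScalar π f f' ∈ D0.scalars f.obj.left.fst.base :=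
  mul_mem (C0.Hom.scalar_mem _) (inv_mem (C0.act_mem_scalars _ (C0.Hom.scalar_mem _)))

/-- The norm condition of the connecting arrow (in fact an equality: it is an isometry).
[cite: MochizukiFrdII2008, Thm 3.6 (vii) p.37] -/
theorem norm_connScalar_mul_tip : ‖(connScalar π f f' : ℂ)‖ * f.obj.left.fst.tip = f'.obj.left.fst.tip := by
  have h1 := (A0.isIsometry_iff_norm_mul_tip_pow _).1 (ImtrPre.isIsometry_fst f)
  have h2 := (A0.isIsometry_iff_norm_mul_tip_pow _).1 (ImtrPre.isIsometry_fst f')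
  rw [ImtrPre.degFr_eq, PNat.one_coe, pow_one] at h1 h2
  rw [connScalar, Units.val_mul, norm_mul, Units.val_inv_eq_inv_val, norm_inv, D0.norm_galAct]
  have hc' : ‖(C0.scalar f'.obj.hom.fst : ℂ)‖ ≠ 0 := norm_ne_zero_iff.mpr (C0.scalar f'.obj.hom.fst).ne_zero
  field_simp
  linarith [h1, h2]

include hle in
/-- The connecting arrow carries directions of `B` into directions of `B'`.
[cite: MochizukiFrdII2008, Thm 3.6 (vii) p.37] -/
theorem dirMap_connScalar_mem {w : ↥(normOneSubgroup ℂ)} (hw : w ∈ f.obj.left.fst.region.dir) :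
    dirMap (D0.Hom.twists (connBase π f f')) (unitPart ℂ (connScalar π f f')) w ∈ f'.obj.left.fst.region.dir := by
  -- notation
  set s := D0.Hom.twists (connBase π f f') with hs
  set t' := D0.Hom.twists (C0.Base f'.obj.hom.fst) with ht'
  set u := unitPart ℂ (C0.scalar f.obj.hom.fst) with hu
  set u' := unitPart ℂ (C0.scalar f'.obj.hom.fst) with hu'
  have ht : D0.Hom.twists (C0.Base f.obj.hom.fst) = xor s t' := twists_connBase π f f'
  -- the direction of `w` under `φ` lies in `dirIm φ'`
  have hmem : dirMap (xor s t') u w ∈ C0.dirIm f'.obj.hom.fst := by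
    rw [← ht]; exact dirIm_subset_of_subset π f f' hle ⟨w, hw, rfl⟩
  obtain ⟨w', hw', hww'⟩ := hmem
  -- solve for `w'`
  have hww : u' * w' = unitGal s (u * w) := by
    apply unitGal_injective t'
    have : dirMap t' u' w' = dirMap (xor s t') u w := hww'
    rw [dirMap, dirMap, unitGal_xor] at this
    exact this
  have hug : unitPart ℂ (connScalar π f f') = u * (unitGal s u')⁻¹ := by
    rw [connScalar, unitPart_mul, unitPart_inv]
    change u * (unitPart ℂ (D0.galAct s _))⁻¹ = _
    rw [unitPart_galAct]
  have hw'eq : w' = u'⁻¹ * (unitGal s u * unitGal s w) := by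
    rw [← unitGal_mul, ← hww, inv_mul_cancel_left]
  have key : dirMap s (unitPart ℂ (connScalar π f f')) w = w' := by
    rw [hw'eq, hug, dirMap, unitGal_mul, unitGal_mul, unitGal_inv, unitGal_unitGal,
      mul_comm (unitGal s u) u'⁻¹, mul_assoc]
  rw [key]; exact hw'

/-- The `C₀`-component of the connecting arrow `B → B'`. [cite: MochizukiFrdII2008, Thm 3.6 (vii) p.37] -/
def connFst : f.obj.left.fst ⟶ f'.obj.left.fst :=
  C0.linHom _ _ (connBase π f f') (connScalar π f f') (connScalar_mem π f f')
    (norm_connScalar_mul_tip π f f').le (fun _ hw => dirMap_connScalar_mem π f f' hle hw)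

/-- The connecting arrow `B → B'` of `C`. [cite: MochizukiFrdII2008, Thm 3.6 (vii) p.37] -/
def connHom : f.obj.left ⟶ f'.obj.left where
  fst := connFst π f f' hle
  snd := connSnd π f f'
  w := by
    change connBase π f f' ≫ f'.obj.left.e.hom = f.obj.left.e.hom ≫ π.map (connSnd π f f')
    rw [connBase, Category.assoc, Category.assoc, Iso.inv_hom_id, Category.comp_id]

/-- The connecting arrow lies over `A`: `conn ≫ φ' = φ`. [cite: MochizukiFrdII2008, Thm 3.6 (vii) p.37] -/
theorem connHom_comp : connHom π f f' hle ≫ f'.obj.hom = f.obj.hom := by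
  haveI := ImtrPre.isIso_snd f'
  refine CFP.hom_ext ?_ ?_
  · change connFst π f f' hle ≫ f'.obj.hom.fst = f.obj.hom.fst
    refine C0.hom_ext (connBase_comp π f f') ?_ ?_
    · rw [C0.degFr_comp', ImtrPre.degFr_eq f', ImtrPre.degFr_eq f]; rfl
    · rw [C0.scalar_comp', ImtrPre.degFr_eq f', PNat.one_coe, pow_one]
      change (connBase π f f').act (C0.scalar f'.obj.hom.fst) * connScalar π f f' = _
      rw [connScalar, mul_comm]
      exact inv_mul_cancel_right _ _
  · change connSnd π f f' ≫ f'.obj.hom.snd = f.obj.hom.snd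
    rw [connSnd, Category.assoc, IsIso.inv_hom_id, Category.comp_id]

/-- The morphism `f → f'` of `C^imtr-pre_A` obtained from an inclusion of boundary images.
[cite: MochizukiFrdII2008, Thm 3.6 (vii) p.37] -/
def connOver : f ⟶ f' :=
  ObjectProperty.homMk (Over.homMk (connHom π f f' hle) (connHom_comp π f f' hle))

end Full

/-- The functor is full. [cite: MochizukiFrdII2008, Thm 3.6 (vii) p.37] -/
theorem full_bdFunctor : (bdFunctor π A).Full :=
  ⟨fun {f f'} k => ⟨connOver π f f' (leOfHom k.hom), TopRep.Open0.hom_eq _ _⟩⟩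

/-! ### Essentially surjective (for complex `A`) -/

section EssSurj

variable {A} (hc : A.fst.IsComplexObj) (U : TopRep.Open0 ↥(bd π A))

/-- The angular part `U/tip(A) ⊆ O_ℂ^×` of a connected open `U ⊆ ∂A_A`.
[cite: MochizukiFrdII2008, Thm 3.6 (vii) p.37] -/
def dirOf : Set ↥(normOneSubgroup ℂ) :=
  Subtype.val '' (A.fst.region.dirHomeoBoundary ⁻¹' (U.obj : Set ↥(bd π A)))

/-- `U/tip(A)` is open. [cite: MochizukiFrdII2008, Thm 3.6 (vii) p.37] -/
theorem isOpen_dirOf : IsOpen (dirOf π U) :=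
  A.fst.region.isOpen_dir.isOpenMap_subtype_val _
    (U.obj.isOpen.preimage (A.fst.region.dirHomeoBoundary).continuous)

/-- `U/tip(A)` is connected. [cite: MochizukiFrdII2008, Thm 3.6 (vii) p.37] -/
theorem isConnected_dirOf : IsConnected (dirOf π U) :=
  ((A.fst.region.dirHomeoBoundary).isConnected_preimage.2 U.property).image _
    continuous_subtype_val.continuousOn

/-- `U/tip(A) ⊆ B_A`. [cite: MochizukiFrdII2008, Thm 3.6 (vii) p.37] -/
theorem dirOf_subset : dirOf π U ⊆ A.fst.region.dir := by
  rintro _ ⟨w, -, rfl⟩; exact w.2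

/-- Membership in `U/tip(A)`: `w ∈ U/tip(A) ↔ w · tip(A) ∈ U`. [cite: MochizukiFrdII2008, Thm 3.6 (vii) p.37] -/
theorem mem_dirOf_iff (x : ↥(bd π A)) : unitPart ℂ (x : ℂˣ) ∈ dirOf π U ↔ x ∈ U.obj := by
  have hxA : unitPart ℂ (x : ℂˣ) ∈ A.fst.region.dir := x.2.1.1
  have hdec : ((unitPart ℂ (x : ℂˣ) : ℂˣ)) * ofPosReal ℂ A.fst.region.tip = (x : ℂˣ) := by
    have h : ((unitPart ℂ (x : ℂˣ) : ℂˣ)) * ofPosReal ℂ (absHom ℂ (x : ℂˣ)) = (x : ℂˣ) :=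
      (unitDecomposition ℂ).apply_symm_apply (x : ℂˣ)
    rw [x.2.2] at h; exact h
  have hhx : A.fst.region.dirHomeoBoundary ⟨unitPart ℂ (x : ℂˣ), hxA⟩ = x :=
    Subtype.ext ((A.fst.region.coe_dirHomeoBoundary _).trans hdec)
  constructor
  · rintro ⟨w, hw, hwx⟩
    have : w = ⟨unitPart ℂ (x : ℂˣ), hxA⟩ := Subtype.ext hwx
    rw [this, Set.mem_preimage, hhx] at hw
    exact hw
  · intro hx
    refine ⟨⟨unitPart ℂ (x : ℂˣ), hxA⟩, ?_, rfl⟩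
    rw [Set.mem_preimage, hhx]
    exact hx

include hc in
/-- The object of `C₀` with the base and tip of `A` and angular part `U/tip(A)` (`A` complex; an
`abbrev` so that its base is reducibly that of `A`). [cite: MochizukiFrdII2008, Thm 3.6 (vii) p.37] -/
abbrev srcObj : C0 where
  base := A.fst.base
  region :=
    { dir := dirOf π U
      tip := A.fst.region.tip
      isOpen_dir := isOpen_dirOf π U
      isConnected_inter := fun z => by
        haveI : ConnectedSpace ↥(normOneSubgroup ℂ) := connectedSpace_iff_univ.mpr isConnected_univ_normOne
        rw [PreconnectedSpace.connectedComponent_eq_univ, Set.inter_univ]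
        exact isConnected_dirOf π U }
  isIsotropic_of_isReal h := absurd (hc.symm.trans h) (by decide)

/-- The object `(srcObj, A_D)` of `C` over the same base as `A`. [cite: MochizukiFrdII2008, Thm 3.6 (vii) p.37] -/
def srcC : C π := ⟨srcObj π hc U, A.snd, A.iso⟩

/-- The arrow `(id, 1, 1) : srcObj → A` of `C₀` (angular part `U/tip(A) ⊆ B_A`, same tip).
[cite: MochizukiFrdII2008, Thm 3.6 (vii) p.37] -/
def srcFst : srcObj π hc U ⟶ A.fst where
  base := 𝟙 A.fst.base
  degFr := 1
  scalar := 1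
  scalar_mem := one_mem _
  mapsTo := by
    rintro _ ⟨v, hv, rfl⟩
    rw [PNat.one_coe, pow_one] at hv
    refine ⟨v, ⟨dirOf_subset π U hv.1, hv.2⟩, ?_⟩
    change D0.galAct (D0.Hom.twists (𝟙 A.fst.base)) v = (1 : ℂˣ) • v
    rw [D0.twists_id, D0.galAct_false, smul_eq_mul, one_mul]

/-- `Base(srcFst)` does not twist. [cite: MochizukiFrdII2008, Def 3.1 (i) p.23] -/
theorem twists_base_srcFst : D0.Hom.twists (C0.Base (srcFst π hc U)) = false := D0.twists_id A.fst.base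

/-- The scalar of `srcFst` is `1`. [cite: MochizukiFrdII2008, Ex 3.3 (i) p.27] -/
theorem scalar_srcFst : C0.scalar (srcFst π hc U) = 1 := rfl

/-- `srcFst` is an isometry (same tip). [cite: MochizukiFrdII2008, Ex 3.3 (iii) p.28] -/
theorem isIsometry_srcFst : PreFrobenioid.IsIsometry C0.toElem (srcFst π hc U) := by
  rw [A0.isIsometry_iff_norm_mul_tip_pow]
  change ‖((1 : ℂˣ) : ℂ)‖ * A.fst.tip ^ ((1 : ℕ+) : ℕ) = A.fst.tip
  rw [Units.val_one, norm_one, one_mul, PNat.one_coe, pow_one]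

/-- The isometric pre-step `srcC → A` of `C`. [cite: MochizukiFrdII2008, Thm 3.6 (vii) p.37] -/
def srcHom : srcC π hc U ⟶ A where
  fst := srcFst π hc U
  snd := 𝟙 A.snd
  w := by
    change 𝟙 _ ≫ A.iso.hom = A.iso.hom ≫ π.map (𝟙 A.snd)
    rw [CategoryTheory.Functor.map_id, Category.id_comp, Category.comp_id]

/-- `srcHom` is an isometry of `C`. [cite: MochizukiFrdII2008, Thm 3.6 (vii) p.37] -/
theorem isIsometry_srcHom : PreFrobenioid.IsIsometry (C.toElem π) (srcHom π hc U) :=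
  isIsometry_srcFst π hc U

/-- `srcHom` is a pre-step of `C` (linear, over the identity). [cite: MochizukiFrdII2008, Thm 3.6 (vii) p.37] -/
theorem isPreStep_srcHom : PreFrobenioid.IsPreStep (C.toElem π) (srcHom π hc U) := by
  refine ⟨rfl, ?_⟩
  change IsIso (𝟙 A.snd); infer_instance

/-- `srcHom` as an object of `C^imtr-pre_A`. [cite: MochizukiFrdII2008, Thm 3.6 (vii) p.37] -/
def srcOver : ImtrPreOver (C.toElem π) A :=
  ⟨Over.mk (srcHom π hc U), ⟨isIsometry_srcHom π hc U, isPreStep_srcHom π hc U⟩⟩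

/-- The direction set of `srcFst` is `U/tip(A)`. [cite: MochizukiFrdII2008, Thm 3.6 (vii) p.37] -/
theorem dirIm_srcFst : C0.dirIm (srcFst π hc U) = dirOf π U := by
  rw [C0.dirIm, twists_base_srcFst, scalar_srcFst, ← Subgroup.coe_one, unitPart_normOne_coe]
  have hid : dirMap false (1 : ↥(normOneSubgroup ℂ)) = id := funext fun w => by simp [dirMap]
  rw [hid, Set.image_id]

/-- The boundary image of `srcOver U` is `U`. [cite: MochizukiFrdII2008, Thm 3.6 (vii) p.37] -/
theorem bdOpen_srcOver : bdOpen π A (srcOver π hc U) = U.obj := by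
  ext x
  rw [SetLike.mem_coe, SetLike.mem_coe, mem_bdOpen_iff_unitPart, ← mem_dirOf_iff π U x]
  change unitPart ℂ (x : ℂˣ) ∈ C0.dirIm (srcFst π hc U) ↔ _
  rw [dirIm_srcFst]

end EssSurj

/-- The functor is essentially surjective, for complex `A`. [cite: MochizukiFrdII2008, Thm 3.6 (vii) p.37] -/
theorem essSurj_bdFunctor (hc : A.fst.IsComplexObj) : (bdFunctor π A).EssSurj where
  mem_essImage U :=
    ⟨srcOver π hc U, ⟨{
      hom := ObjectProperty.homMk (homOfLE (le_of_eq (bdOpen_srcOver π hc U)))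
      inv := ObjectProperty.homMk (homOfLE (le_of_eq (bdOpen_srcOver π hc U).symm))
      hom_inv_id := TopRep.Open0.hom_eq _ _
      inv_hom_id := TopRep.Open0.hom_eq _ _ }⟩⟩

/-- **The functor of Theorem 3.6 (vii) is an equivalence** `C^imtr-pre_A ⥲ Open⁰(∂A_A)` for complex `A`.
[cite: MochizukiFrdII2008, Thm 3.6 (vii) p.37] -/
theorem isEquivalence_bdFunctor (hc : A.fst.IsComplexObj) : (bdFunctor π A).IsEquivalence where
  faithful := faithful_bdFunctor π A
  full := full_bdFunctor π A
  essSurj := essSurj_bdFunctor π A hc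

/-- **Theorem 3.6 (vii), the equivalence `F^imtr-pre_A ⥲ Open⁰(∂A_A)`, for `C = C^ℤ`** (PROVED over any base
`π : D → D₀`): for complex `A ∈ Ob(C)` the boundary-image assignment is an equivalence of categories.
[cite: MochizukiFrdII2008, Thm 3.6 (vii) p.37] -/
theorem thm36vii_equiv_C :
    Thm36vii_equiv (baseRC π) (C.toElem π) MonoidType.Z (ambient π) (bd π) (vMap π) := by
  intro _ A hAc
  have hπ : (π.obj A.snd).IsComplex := (D0.isComplex_toArchBase_iff _).mp hAc
  have hc : A.fst.IsComplexObj := by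
    have e : A.fst.base ⟶ π.obj A.snd := A.iso.hom
    rw [show π.obj A.snd = D0.complex from hπ] at e
    exact D0.eq_complex_of_hom_complex e
  haveI := isEquivalence_bdFunctor π A hc
  exact ⟨(bdFunctor π A).asEquivalence, fun f => coe_image_bdOpen π A f⟩

end ArchFrd

end

end Literature.AlgebraicGeometry.Frobenioids
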